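import Literature.Analysis.FluidPDE.TaoY6LocalBiotSavart
import Literature.Analysis.FluidPDE.TaoY6PieceIBP
import Literature.Analysis.FluidPDE.TaoY6PieceBounds
import Literature.Analysis.FluidPDE.TaoWhitneyKernel
import HarnessLib

/-!
# The `Y₆` estimate on one Whitney piece

Analysis/FluidPDE support file for the discharge of the named fact
`Literature.Analysis.FluidPDE.tao2011_nonlinearEstimate` (Tao 2011, §10, proof of Thm. 10.1,
estimate of `Y₆ = ∫ O(ω ω ∇u) η`, arXiv:1108.1165 pp. 32–33). A **piece** of the annulus
`Ω = {a < |y − x₀| < b}` (cutoff `η = annularRamp k a b |· − x₀|`, `0 < a`, `a + 2/k < b`) is a `C¹`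
compactly supported cutoff `0 ≤ χ ≤ 1` together with a scale `r` and a level `θ` such that
`k r = θ/32`, `θ ≤ η ≤ 4θ` on `supp χ`, `‖Dχ‖ ≤ L` with `θ L ≤ c_L k`, and the Whitney-scale mass
bound `∫_{B(y,5r)} |ω|² ≤ c_M r Λ` at every point of `supp χ` (the dyadic shells and the core of
`FluidPDE/TaoY6Cutoffs` are pieces, `FluidPDE/TaoY6ShellPieces`). For such a piece and a smooth
divergence-free `u` with `ω = curl u` we prove (`abs_integral_inner_fderiv_piece_le`)

  `|∫ ⟪ω, Du ω⟫ η χ| ≤ B_V ∫ |ω|² η χ + 6 √(C_Γ C_c (16k)⁻¹ · W₂ · D_χ · D̃)`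
                   `+ 3 (1 + 4 c_L) √(C_Γ C_c c_M / 512 · Λ · D̃ · W'_χ)`,

where `B_V` bounds the gradient of the far field at scale `r` (to be chosen as `C₁ s/r` on the
shells and `C₂^{1/2} r^{-5/2} ‖u‖_{L²}` on the core, `FluidPDE/TaoY6LocalBiotSavart`),
`W₂ = ∫|ω|²η`, `D_χ = ∫|Dω|²ηχ`, `D̃ = ∫_N |Dω|²η` over the closed `2r`-neighbourhood `N` of
`supp χ`, `W'_χ = ∫_{supp χ} |ω|²η`, `C_Γ = ∫ (Γ₀^{1,2})²`, `C_c = ‖curlCLM‖²`. This is the sum of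
Tao's `Y₆,₂` (far field) and `Y₆,₁` (near field, after the integration by parts of
`FluidPDE/TaoY6PieceIBP` and the two Cauchy–Schwarz/Tonelli bounds of `FluidPDE/TaoY6PieceBounds`)
for one scale of the Whitney decomposition.

## References

* T. Tao, arXiv:1108.1165 (`Tao2011`), §10, proof of Thm. 10.1, pp. 32–33 (`Y₆ = Y₆,₁ + Y₆,₂`).
-/

noncomputable section

open MeasureTheory Set Filter Metric Function Real InnerProductSpace
open scoped RealInnerProductSpace NNReal

namespace Literature.Analysis.FluidPDE.TaoY6

/-! ### The annular cutoff as a Lipschitz compactly supported weight -/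

section Eta

variable {x₀ : EuclideanSpace ℝ (Fin 3)} {k a b : ℝ}

/-- `η = annularRamp k a b |· − x₀|` is `k`-Lipschitz (`k ≥ 0`). [folklore] -/
theorem lipschitzWith_annularRamp_norm_sub (hk : 0 ≤ k) (x₀ : EuclideanSpace ℝ (Fin 3)) (a b : ℝ) :
    LipschitzWith (Real.toNNReal k)
      fun y : EuclideanSpace ℝ (Fin 3) => annularRamp k a b ‖y - x₀‖ :=
  LipschitzWith.of_dist_le_mul fun y z => by
    rw [Real.dist_eq, dist_eq_norm, Real.coe_toNNReal _ hk]
    exact abs_annularRamp_norm_sub_sub_le hk y z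

/-- `η` vanishes off the closed ball of radius `b`, hence has compact support. [folklore] -/
theorem hasCompactSupport_annularRamp_norm_sub (hk : 0 ≤ k) (x₀ : EuclideanSpace ℝ (Fin 3))
    (a b : ℝ) :
    HasCompactSupport fun y : EuclideanSpace ℝ (Fin 3) => annularRamp k a b ‖y - x₀‖ := by
  refine HasCompactSupport.intro (isCompact_closedBall x₀ b) fun y hy => ?_
  rw [mem_closedBall, dist_eq_norm, not_le] at hy
  exact annularRamp_eq_zero_of_outer_le hk hy.le

/-- On the closed `2r`-neighbourhood of a set where `η ≥ θ`, one has `η ≥ θ/2` provided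
`2 k r ≤ θ/2` (`η` is `k`-Lipschitz). [folklore] -/
theorem annularRamp_ge_half_of_mem_cthickening (hk : 0 ≤ k) {S : Set (EuclideanSpace ℝ (Fin 3))}
    (hS : IsCompact S) {θ r : ℝ} (hr : 0 ≤ r) (hkr : 2 * (k * (2 * r)) ≤ θ)
    (hθS : ∀ y ∈ S, θ ≤ annularRamp k a b ‖y - x₀‖) {x : EuclideanSpace ℝ (Fin 3)}
    (hx : x ∈ cthickening (2 * r) S) : θ / 2 ≤ annularRamp k a b ‖x - x₀‖ := by
  rw [hS.cthickening_eq_biUnion_closedBall (by positivity)] at hx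
  obtain ⟨y, hy, hxy⟩ := mem_iUnion₂.1 hx
  rw [mem_closedBall, dist_eq_norm] at hxy
  have h := abs_annularRamp_norm_sub_sub_le (x₀ := x₀) (a := a) (b := b) hk x y
  rw [abs_le] at h
  have := hθS y hy
  nlinarith [h.1]

end Eta

/-! ### The piece estimate -/

section Piece

variable {x₀ : EuclideanSpace ℝ (Fin 3)} {k a b : ℝ}
  {u : EuclideanSpace ℝ (Fin 3) → EuclideanSpace ℝ (Fin 3)}
  {χ : EuclideanSpace ℝ (Fin 3) → ℝ} {r θ L cL cM Λ BV : ℝ}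

/-- **The `Y₆` estimate on one Whitney piece** (Tao's `Y₆,₁ + Y₆,₂` at one scale, pp. 32–33; see
the module docstring for the dictionary). [cite: Tao2011, §10, proof of Thm. 10.1 (pp. 32–33, Y₆ = Y₆,₁ + Y₆,₂)] -/
theorem abs_integral_inner_fderiv_piece_le (hk : 0 < k) (hu : ContDiff ℝ 4 u)
    (hdiv : VectorCalculus.IsDivFree u)
    (hχ : ContDiff ℝ 1 χ) (hχc : HasCompactSupport χ) (hχ01 : ∀ y, χ y ∈ Icc (0 : ℝ) 1)
    (hL : ∀ y, ‖fderiv ℝ χ y‖ ≤ L) (hcL : θ * L ≤ cL * k) (hcL0 : 0 ≤ cL)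
    (hr : 0 < r) (hθ : 0 < θ) (hkr : k * r = θ / 32)
    (hηS : ∀ y ∈ tsupport χ,
      θ ≤ annularRamp k a b ‖y - x₀‖ ∧ annularRamp k a b ‖y - x₀‖ ≤ 4 * θ)
    (hcM : 0 ≤ cM) (hΛ : 0 ≤ Λ)
    (hmass : ∀ y ∈ tsupport χ, ∫ x in ball y (5 * r), ‖curl u x‖ ^ 2 ≤ cM * r * Λ)
    (hBV : ∀ y, ‖fderiv ℝ (fun y => ∫ z, newtonFarLaplacian r (2 * r) z • u (y - z)) y‖ ≤ BV) :
    |∫ y, ⟪curl u y, fderiv ℝ u y (curl u y)⟫ * (annularRamp k a b ‖y - x₀‖ * χ y)| ≤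
      BV * (∫ y, ‖curl u y‖ ^ 2 * (annularRamp k a b ‖y - x₀‖ * χ y)) +
      6 * Real.sqrt ((∫ z, newtonNear 1 2 z ^ 2) * ‖curlCLM‖ ^ 2 / (16 * k) *
          (∫ y, ‖curl u y‖ ^ 2 * annularRamp k a b ‖y - x₀‖) *
          ((∫ y, frobeniusNormSq (fderiv ℝ (curl u) y) * (annularRamp k a b ‖y - x₀‖ * χ y)) *
            ∫ y in cthickening (2 * r) (tsupport χ),
              frobeniusNormSq (fderiv ℝ (curl u) y) * annularRamp k a b ‖y - x₀‖)) +
      3 * (1 + 4 * cL) * Real.sqrt ((∫ z, newtonNear 1 2 z ^ 2) * ‖curlCLM‖ ^ 2 * cM / 512 * Λ *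
          ((∫ y in cthickening (2 * r) (tsupport χ),
              frobeniusNormSq (fderiv ℝ (curl u) y) * annularRamp k a b ‖y - x₀‖) *
            ∫ y in tsupport χ, ‖curl u y‖ ^ 2 * annularRamp k a b ‖y - x₀‖)) := by
  -- names
  set η : EuclideanSpace ℝ (Fin 3) → ℝ := fun y => annularRamp k a b ‖y - x₀‖ with hηdef
  set ω : EuclideanSpace ℝ (Fin 3) → EuclideanSpace ℝ (Fin 3) := curl u with hωdef
  set Φ : EuclideanSpace ℝ (Fin 3) → ℝ := fun y => frobeniusNormSq (fderiv ℝ ω y) with hΦdef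
  set H : EuclideanSpace ℝ (Fin 3) → EuclideanSpace ℝ (Fin 3) :=
    fun y => ∫ z, newtonNear r (2 * r) z • curl (curl u) (y - z) with hHdef
  set V : EuclideanSpace ℝ (Fin 3) → EuclideanSpace ℝ (Fin 3) :=
    fun y => ∫ z, newtonFarLaplacian r (2 * r) z • u (y - z) with hVdef
  set CΓ : ℝ := ∫ z, newtonNear 1 2 z ^ 2 with hCΓ
  set Cc : ℝ := ‖curlCLM‖ ^ 2 with hCc
  set W₂ : ℝ := ∫ y, ‖ω y‖ ^ 2 * η y with hW₂
  set Dχ : ℝ := ∫ y, Φ y * (η y * χ y) with hDχ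
  set Dt : ℝ := ∫ y in (cthickening (2 * r) (tsupport χ)), Φ y * η y with hDt
  set W' : ℝ := ∫ y in (tsupport χ), ‖ω y‖ ^ 2 * η y with hW'
  -- regularity
  have hu2 : ContDiff ℝ 2 u := hu.of_le (by norm_cast)
  have hω3 : ContDiff ℝ 3 ω := contDiff_curl (n := 3) hu
  have hω1 : ContDiff ℝ 1 ω := hω3.of_le (by norm_cast)
  have hωc : Continuous ω := hω1.continuous
  have hDω : Continuous (fderiv ℝ ω) := hω1.continuous_fderiv one_ne_zero
  have hcc : ContDiff ℝ 1 (curl ω) := contDiff_curl (n := 1) (hω3.of_le (by norm_cast))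
  have hH1 : ContDiff ℝ 1 H := contDiff_one_newtonNearField hr hu
  have hV1 : ContDiff ℝ 1 V := contDiff_one_farField hr (hu.of_le (by norm_cast))
  have hHc : Continuous H := hH1.continuous
  have hΦc : Continuous Φ := continuous_frobeniusNormSq_fderiv hω1 one_ne_zero
  have hΦ0 : ∀ y, 0 ≤ Φ y := fun y => frobeniusNormSq_nonneg _
  have hχ0 : ∀ y, 0 ≤ χ y := fun y => (hχ01 y).1
  have hχcont : Continuous χ := hχ.continuous
  have hS : IsCompact (tsupport χ) := hχc
  -- the weight
  have hη0 : ∀ y, 0 ≤ η y := fun y => annularRamp_nonneg _ _ _ _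
  have hηL : LipschitzWith (Real.toNNReal k) η := lipschitzWith_annularRamp_norm_sub hk.le x₀ a b
  have hηcs : HasCompactSupport η := hasCompactSupport_annularRamp_norm_sub hk.le x₀ a b
  have hηc : Continuous η := hηL.continuous
  have hθS : ∀ y ∈ (tsupport χ), θ ≤ η y := fun y hy => (hηS y hy).1
  have hηN : ∀ x ∈ (cthickening (2 * r) (tsupport χ)), θ / 2 ≤ η x := fun x hx =>
    annularRamp_ge_half_of_mem_cthickening hk.le hS hr.le (by nlinarith) hθS hx
  -- integrability of the standing weighted quantities
  have hWint : Integrable fun y => ‖ω y‖ ^ 2 * η y :=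
    ((hωc.norm.pow 2).mul hηc).integrable_of_hasCompactSupport hηcs.mul_left
  have hW0 : 0 ≤ W₂ := integral_nonneg fun y => mul_nonneg (sq_nonneg _) (hη0 y)
  have hDχ0 : 0 ≤ Dχ := integral_nonneg fun y => mul_nonneg (hΦ0 y) (mul_nonneg (hη0 y) (hχ0 y))
  have hDt0 : 0 ≤ Dt := integral_nonneg fun y => mul_nonneg (hΦ0 y) (hη0 y)
  have hW'0 : 0 ≤ W' := integral_nonneg fun y => mul_nonneg (sq_nonneg _) (hη0 y)
  have hCΓ0 : 0 ≤ CΓ := integral_sq_newtonNear_nonneg _ _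
  have hCc0 : 0 ≤ Cc := sq_nonneg _
  -- Step 1: `Du = -DH + DV` and the splitting of the integrand
  have hDu : ∀ y, fderiv ℝ u y = -fderiv ℝ H y + fderiv ℝ V y := fun y =>
    fderiv_eq_neg_fderiv_newtonNearField_add hr hu hdiv y
  have hsplit_pt : ∀ y, ⟪ω y, fderiv ℝ u y (ω y)⟫ * (η y * χ y) =
      ⟪ω y, fderiv ℝ V y (ω y)⟫ * (η y * χ y) - ⟪ω y, fderiv ℝ H y (ω y)⟫ * (η y * χ y) := fun y => by
    rw [hDu y, _root_.add_apply, _root_.neg_apply, inner_add_right, inner_neg_right]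
    ring
  have hintV : Integrable fun y => ⟪ω y, fderiv ℝ V y (ω y)⟫ * (η y * χ y) :=
    ((hωc.inner ((hV1.continuous_fderiv one_ne_zero).clm_apply hωc)).mul (hηc.mul hχcont))
      |>.integrable_of_hasCompactSupport hχc.mul_left.mul_left
  have hintH : Integrable fun y => ⟪ω y, fderiv ℝ H y (ω y)⟫ * (η y * χ y) :=
    ((hωc.inner ((hH1.continuous_fderiv one_ne_zero).clm_apply hωc)).mul (hηc.mul hχcont))
      |>.integrable_of_hasCompactSupport hχc.mul_left.mul_left
  have hsplit : ∫ y, ⟪ω y, fderiv ℝ u y (ω y)⟫ * (η y * χ y) =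
      (∫ y, ⟪ω y, fderiv ℝ V y (ω y)⟫ * (η y * χ y)) - ∫ y, ⟪ω y, fderiv ℝ H y (ω y)⟫ * (η y * χ y) := by
    simp_rw [hsplit_pt]
    exact integral_sub hintV hintH
  -- Step 2: the far field
  have hVbd : |∫ y, ⟪ω y, fderiv ℝ V y (ω y)⟫ * (η y * χ y)| ≤ BV * ∫ y, ‖ω y‖ ^ 2 * (η y * χ y) := by
    rw [← integral_const_mul, ← Real.norm_eq_abs]
    have hcs3 : HasCompactSupport fun y => BV * (‖ω y‖ ^ 2 * (η y * χ y)) :=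
      hχc.mul_left.mul_left.mul_left
    refine norm_integral_le_of_norm_le ((((hωc.norm.pow 2).mul (hηc.mul hχcont)).const_mul BV)
      |>.integrable_of_hasCompactSupport hcs3) (Eventually.of_forall fun y => ?_)
    rw [Real.norm_eq_abs, abs_mul, abs_of_nonneg (mul_nonneg (hη0 y) (hχ0 y))]
    have h1 : |⟪ω y, fderiv ℝ V y (ω y)⟫| ≤ BV * ‖ω y‖ ^ 2 := by
      calc |⟪ω y, fderiv ℝ V y (ω y)⟫| ≤ ‖ω y‖ * ‖fderiv ℝ V y (ω y)‖ := abs_real_inner_le_norm _ _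
        _ ≤ ‖ω y‖ * (BV * ‖ω y‖) := by
            refine mul_le_mul_of_nonneg_left ?_ (norm_nonneg _)
            exact (ContinuousLinearMap.le_opNorm _ _).trans
              (mul_le_mul_of_nonneg_right (hBV y) (norm_nonneg _))
        _ = BV * ‖ω y‖ ^ 2 := by ring
    calc |⟪ω y, fderiv ℝ V y (ω y)⟫| * (η y * χ y) ≤ BV * ‖ω y‖ ^ 2 * (η y * χ y) :=
          mul_le_mul_of_nonneg_right h1 (mul_nonneg (hη0 y) (hχ0 y))
      _ = BV * (‖ω y‖ ^ 2 * (η y * χ y)) := by ring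
  -- Step 3: the near field, integrated by parts
  have hHbd := abs_integral_inner_fderiv_apply_self_le_of_piece (EuclideanSpace.basisFun (Fin 3) ℝ)
    hω1 hH1 hχ hχc hχ01 hL hk.le hηL hηcs hη0 (fun y hy => (hηS y hy).2) hcL
  rw [Fintype.card_fin] at hHbd
  set I : ℝ := ∫ y, ‖fderiv ℝ ω y‖ * ‖ω y‖ * ‖H y‖ * (η y * χ y) with hI
  set II : ℝ := ∫ y in (tsupport χ), ‖ω y‖ ^ 2 * ‖H y‖ with hII
  have hI0 : 0 ≤ I := integral_nonneg fun y => by have := hη0 y; have := hχ0 y; positivity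
  have hII0 : 0 ≤ II := integral_nonneg fun y => by positivity
  -- Step 4: the pointwise near-field bound `‖H y‖² ≤ C_H ∫_{B̄(y,2r)} Φ`
  have hHpt : ∀ y, ‖H y‖ ^ 2 ≤ CΓ * r * Cc * ∫ x in closedBall y (2 * r), Φ x := by
    intro y
    have h1 := norm_sq_integral_newtonNear_smul_le hr hcc.continuous y
    rw [integral_sq_newtonNear_two_mul hr] at h1
    have h2 : ∫ x in closedBall y (2 * r), ‖curl (curl u) x‖ ^ 2 ≤
        Cc * ∫ x in closedBall y (2 * r), Φ x := by
      rw [← integral_const_mul]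
      refine setIntegral_mono_on
        ((hcc.continuous.norm.pow 2).continuousOn.integrableOn_compact (isCompact_closedBall _ _))
        ((continuous_const.mul hΦc).continuousOn.integrableOn_compact (isCompact_closedBall _ _))
        measurableSet_closedBall fun x _ => ?_
      exact norm_curl_sq_le_frobeniusNormSq ω x
    calc ‖H y‖ ^ 2 ≤ r * CΓ * ∫ x in closedBall y (2 * r), ‖curl (curl u) x‖ ^ 2 := h1
      _ ≤ r * CΓ * (Cc * ∫ x in closedBall y (2 * r), Φ x) :=
          mul_le_mul_of_nonneg_left h2 (by positivity)
      _ = CΓ * r * Cc * ∫ x in closedBall y (2 * r), Φ x := by ring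
  have hCH : 0 ≤ CΓ * r * Cc := by positivity
  -- Step 5: the bound for `I`
  have hIsq := sq_integral_mul_norm_mul_le (μ := volume) (ω := ω) (H := H) (A := fun y => ‖fderiv ℝ ω y‖)
    (Φ := Φ) (w := fun y => η y * χ y) (η := η) hωc hHc hDω.norm (fun y => norm_nonneg _) hΦc hΦ0
    (hηc.mul hχcont) hχc.mul_left (fun y => mul_nonneg (hη0 y) (hχ0 y))
    (fun y => by
      calc η y * χ y ≤ η y * 1 := mul_le_mul_of_nonneg_left (hχ01 y).2 (hη0 y)
        _ = η y := mul_one _)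
    hWint hCH (by positivity : (0 : ℝ) ≤ 2 * r) hHpt
  -- support of `η χ` is inside `(tsupport χ)`, so its neighbourhood is inside `(cthickening (2 * r) (tsupport χ))`
  have hNsub : cthickening (2 * r) (tsupport fun y => η y * χ y) ⊆ cthickening (2 * r) (tsupport χ) :=
    cthickening_subset_of_subset _ (tsupport_mul_subset_right (f := η) (g := χ))
  have hA2 : ∫ y, ‖fderiv ℝ ω y‖ ^ 2 * (η y * χ y) ≤ Dχ :=
    integral_mono_of_nonneg (Eventually.of_forall fun y => mul_nonneg (sq_nonneg _)
      (mul_nonneg (hη0 y) (hχ0 y)))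
      (((hΦc.mul (hηc.mul hχcont))).integrable_of_hasCompactSupport hχc.mul_left.mul_left)
      (Eventually.of_forall fun y => mul_le_mul_of_nonneg_right (sq_opNorm_le_frobeniusNormSq _)
        (mul_nonneg (hη0 y) (hχ0 y)))
  have hPN : ∫ x in cthickening (2 * r) (tsupport fun y => η y * χ y), Φ x ≤ (θ / 2)⁻¹ * Dt := by
    have hNc : IsCompact (cthickening (2 * r) (tsupport χ)) := hS.cthickening
    calc ∫ x in cthickening (2 * r) (tsupport fun y => η y * χ y), Φ x ≤ ∫ x in (cthickening (2 * r) (tsupport χ)), Φ x :=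
          setIntegral_mono_set (hΦc.continuousOn.integrableOn_compact hNc)
            (Eventually.of_forall hΦ0) (Eventually.of_forall hNsub)
      _ ≤ ∫ x in (cthickening (2 * r) (tsupport χ)), (θ / 2)⁻¹ * (Φ x * η x) := by
          refine setIntegral_mono_on (hΦc.continuousOn.integrableOn_compact hNc)
            ((continuous_const.mul (hΦc.mul hηc)).continuousOn.integrableOn_compact hNc)
            isClosed_cthickening.measurableSet fun x hx => ?_
          have hηx := hηN x hx
          have : Φ x * (θ / 2) ≤ Φ x * η x := mul_le_mul_of_nonneg_left hηx (hΦ0 x)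
          calc Φ x = (θ / 2)⁻¹ * (Φ x * (θ / 2)) := by field_simp
            _ ≤ (θ / 2)⁻¹ * (Φ x * η x) := mul_le_mul_of_nonneg_left this (by positivity)
      _ = (θ / 2)⁻¹ * Dt := integral_const_mul _ _
  have hIX : I ^ 2 ≤ CΓ * Cc / (16 * k) * W₂ * (Dχ * Dt) := by
    have h2 : (∫ y, ‖fderiv ℝ ω y‖ ^ 2 * (η y * χ y)) * (CΓ * r * Cc * W₂ *
          ∫ x in cthickening (2 * r) (tsupport fun y => η y * χ y), Φ x) ≤
        Dχ * (CΓ * r * Cc * W₂ * ((θ / 2)⁻¹ * Dt)) :=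
      mul_le_mul hA2 (mul_le_mul_of_nonneg_left hPN
        (mul_nonneg (mul_nonneg (mul_nonneg hCΓ0 hr.le) hCc0) hW0))
        (mul_nonneg (mul_nonneg (mul_nonneg (mul_nonneg hCΓ0 hr.le) hCc0) hW0)
          (integral_nonneg fun x => hΦ0 x)) hDχ0
    have h3 : Dχ * (CΓ * r * Cc * W₂ * ((θ / 2)⁻¹ * Dt)) = CΓ * Cc / (16 * k) * W₂ * (Dχ * Dt) := by
      have e1 : Dχ * (CΓ * r * Cc * W₂ * ((θ / 2)⁻¹ * Dt)) =
          CΓ * Cc * W₂ * (Dχ * Dt) * (k⁻¹ * ((k * r) * (θ / 2)⁻¹)) := by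
        field_simp
      have e2 : k⁻¹ * ((θ / 32) * (θ / 2)⁻¹) = 1 / (16 * k) := by
        field_simp
        ring
      rw [e1, hkr, e2]
      ring
    exact (hIsq.trans h2).trans_eq h3
  have hIle : I ≤ Real.sqrt (CΓ * Cc / (16 * k) * W₂ * (Dχ * Dt)) :=
    (le_abs_self I).trans (Real.abs_le_sqrt hIX)
  -- Step 6: the bound for `II`
  have hm : ∀ x, ∫ y in closedBall x (2 * r) ∩ (tsupport χ), ‖ω y‖ ^ 2 ≤ cM * r * Λ := by
    intro x
    by_cases hx : (closedBall x (2 * r) ∩ (tsupport χ)).Nonempty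
    · obtain ⟨y₀, hy₀B, hy₀S⟩ := hx
      have hsub : closedBall x (2 * r) ∩ (tsupport χ) ⊆ ball y₀ (5 * r) := by
        intro z hz
        rw [mem_ball]
        have h1 := mem_closedBall.1 hz.1
        have h2 := mem_closedBall.1 hy₀B
        linarith [dist_triangle z x y₀, dist_comm x y₀]
      calc ∫ y in closedBall x (2 * r) ∩ (tsupport χ), ‖ω y‖ ^ 2 ≤ ∫ y in ball y₀ (5 * r), ‖ω y‖ ^ 2 :=
            setIntegral_mono_set ((hωc.norm.pow 2).continuousOn.integrableOn_compact
              (isCompact_closedBall y₀ (5 * r)) |>.mono_set ball_subset_closedBall)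
              (Eventually.of_forall fun y => sq_nonneg _) (Eventually.of_forall hsub)
        _ ≤ cM * r * Λ := hmass y₀ hy₀S
    · rw [not_nonempty_iff_eq_empty] at hx
      rw [hx, Measure.restrict_empty, integral_zero_measure]
      positivity
  have hIIsq := sq_setIntegral_sq_norm_mul_norm_le (μ := volume) (ω := ω) (H := H) (Φ := Φ) hS hωc hHc
    hΦc hΦ0 hCH (by positivity : (0 : ℝ) ≤ 2 * r) (by positivity : 0 ≤ cM * r * Λ) hHpt hm
  have hMS : ∫ y in (tsupport χ), ‖ω y‖ ^ 2 ≤ θ⁻¹ * W' := by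
    calc ∫ y in (tsupport χ), ‖ω y‖ ^ 2 ≤ ∫ y in (tsupport χ), θ⁻¹ * (‖ω y‖ ^ 2 * η y) := by
          refine setIntegral_mono_on ((hωc.norm.pow 2).continuousOn.integrableOn_compact hS)
            ((continuous_const.mul ((hωc.norm.pow 2).mul hηc)).continuousOn.integrableOn_compact hS)
            hS.isClosed.measurableSet fun y hy => ?_
          have : ‖ω y‖ ^ 2 * θ ≤ ‖ω y‖ ^ 2 * η y := mul_le_mul_of_nonneg_left (hθS y hy) (sq_nonneg _)
          calc ‖ω y‖ ^ 2 = θ⁻¹ * (‖ω y‖ ^ 2 * θ) := by field_simp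
            _ ≤ θ⁻¹ * (‖ω y‖ ^ 2 * η y) := mul_le_mul_of_nonneg_left this (by positivity)
      _ = θ⁻¹ * W' := integral_const_mul _ _
  have hPN' : ∫ x in (cthickening (2 * r) (tsupport χ)), Φ x ≤ (θ / 2)⁻¹ * Dt := by
    have hNc : IsCompact (cthickening (2 * r) (tsupport χ)) := hS.cthickening
    calc ∫ x in (cthickening (2 * r) (tsupport χ)), Φ x ≤ ∫ x in (cthickening (2 * r) (tsupport χ)), (θ / 2)⁻¹ * (Φ x * η x) := by
          refine setIntegral_mono_on (hΦc.continuousOn.integrableOn_compact hNc)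
            ((continuous_const.mul (hΦc.mul hηc)).continuousOn.integrableOn_compact hNc)
            isClosed_cthickening.measurableSet fun x hx => ?_
          have hηx := hηN x hx
          have : Φ x * (θ / 2) ≤ Φ x * η x := mul_le_mul_of_nonneg_left hηx (hΦ0 x)
          calc Φ x = (θ / 2)⁻¹ * (Φ x * (θ / 2)) := by field_simp
            _ ≤ (θ / 2)⁻¹ * (Φ x * η x) := mul_le_mul_of_nonneg_left this (by positivity)
      _ = (θ / 2)⁻¹ * Dt := integral_const_mul _ _
  have hIIX : (k * II) ^ 2 ≤ CΓ * Cc * cM / 512 * Λ * (Dt * W') := by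
    have hMS0 : 0 ≤ ∫ y in tsupport χ, ‖ω y‖ ^ 2 := integral_nonneg fun y => sq_nonneg (‖ω y‖)
    have hC₀0 : 0 ≤ CΓ * r * Cc * (cM * r * Λ) :=
      mul_nonneg (mul_nonneg (mul_nonneg hCΓ0 hr.le) hCc0) (mul_nonneg (mul_nonneg hcM hr.le) hΛ)
    have hθ2 : 0 ≤ (θ / 2)⁻¹ := by positivity
    have h2 : CΓ * r * Cc * (cM * r * Λ) * (∫ x in cthickening (2 * r) (tsupport χ), Φ x) *
        (∫ y in tsupport χ, ‖ω y‖ ^ 2) ≤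
        CΓ * r * Cc * (cM * r * Λ) * ((θ / 2)⁻¹ * Dt) * (θ⁻¹ * W') :=
      mul_le_mul (mul_le_mul_of_nonneg_left hPN' hC₀0) hMS hMS0
        (mul_nonneg hC₀0 (mul_nonneg hθ2 hDt0))
    have h3 : (k * II) ^ 2 ≤ k ^ 2 * (CΓ * r * Cc * (cM * r * Λ) * ((θ / 2)⁻¹ * Dt) * (θ⁻¹ * W')) := by
      rw [mul_pow]
      exact mul_le_mul_of_nonneg_left (hIIsq.trans h2) (sq_nonneg _)
    have h4 : k ^ 2 * (CΓ * r * Cc * (cM * r * Λ) * ((θ / 2)⁻¹ * Dt) * (θ⁻¹ * W')) =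
        CΓ * Cc * cM / 512 * Λ * (Dt * W') := by
      have e1 : k ^ 2 * (CΓ * r * Cc * (cM * r * Λ) * ((θ / 2)⁻¹ * Dt) * (θ⁻¹ * W')) =
          CΓ * Cc * cM * Λ * (Dt * W') * ((k * r) ^ 2 * ((θ / 2)⁻¹ * θ⁻¹)) := by ring
      have e2 : (θ / 32) ^ 2 * ((θ / 2)⁻¹ * θ⁻¹) = 1 / 512 := by
        field_simp
        ring
      rw [e1, hkr, e2]
      ring
    exact h3.trans_eq h4
  have hIIle : k * II ≤ Real.sqrt (CΓ * Cc * cM / 512 * Λ * (Dt * W')) :=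
    (le_abs_self _).trans (Real.abs_le_sqrt hIIX)
  -- Step 7: assemble
  rw [hsplit]
  have hcL1 : 0 ≤ 3 * (1 + 4 * cL) := by positivity
  calc |(∫ y, ⟪ω y, fderiv ℝ V y (ω y)⟫ * (η y * χ y)) - ∫ y, ⟪ω y, fderiv ℝ H y (ω y)⟫ * (η y * χ y)|
      ≤ |∫ y, ⟪ω y, fderiv ℝ V y (ω y)⟫ * (η y * χ y)| + |∫ y, ⟪ω y, fderiv ℝ H y (ω y)⟫ * (η y * χ y)| :=
        abs_sub _ _
    _ ≤ BV * (∫ y, ‖ω y‖ ^ 2 * (η y * χ y)) + 3 * (2 * I + (1 + 4 * cL) * k * II) :=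
        add_le_add hVbd hHbd
    _ = BV * (∫ y, ‖ω y‖ ^ 2 * (η y * χ y)) + 6 * I + 3 * (1 + 4 * cL) * (k * II) := by ring
    _ ≤ BV * (∫ y, ‖ω y‖ ^ 2 * (η y * χ y)) +
          6 * Real.sqrt (CΓ * Cc / (16 * k) * W₂ * (Dχ * Dt)) +
          3 * (1 + 4 * cL) * Real.sqrt (CΓ * Cc * cM / 512 * Λ * (Dt * W')) := by
        gcongr

end Piece

end Literature.Analysis.FluidPDE.TaoY6

end
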